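import Literature.AlgebraicGeometry.Frobenioids.FrobenioidRealification
import Literature.AlgebraicGeometry.Frobenioids.RealificationDataCanonical
import Literature.AlgebraicGeometry.Frobenioids.RealificationModelRow
import HarnessLib

/-!
# Frobenioids I, Prop. 5.3: THE realification `C^rlf` — the schema parameter `R` of
# `FrobenioidRealification.lean` instantiated at THE data `RealificationData.canonical`

Mochizuki, *The geometry of Frobenioids I: the general theory*, Kyushu J. Math. **62** (2008) 293–400,
§5, Proposition 5.3 p. 103 [cite: MochizukiFrdI2008, Prop. 5.3 p.103]: "Suppose that `Φ` is perf-factorial.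
Then we shall refer to as the realification `C^rlf` of the Frobenioid `C` the model Frobenioid [cf. Theorem
5.2, (ii)] associated to the divisor monoid `Φ^rlf` [i.e., the 'realification' of Definition 2.4, (i)] and
the rational function monoid `ℝ · Φ^birat ⊆ (Φ^rlf)^gp` … there is a natural 1-commutative diagram of functors
… `C^un-tr → (C^un-tr)^pf → C^rlf`".

`FrobenioidRealification.lean` (seat abc-iut-L1-t5) types `realification F R` over a realification datum
`R : RealificationData Φ` (SCHEMA label: "faithful to print only when instantiated with THE construction").
THE construction is `RealificationData.canonical Φ hΦ` (`RealificationDataCanonical.lean`); this file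
performs the instantiation and assembles the bottom row of the diagram of Prop. 5.3 in the model
description at THE data:

* `PreFrobenioid.rlf F hΦ` := `realification F (RealificationData.canonical Φ hΦ.op)` — **THE `C^rlf`**
  (model Frobenioid of `(Φ^rlf, ℝ · Φ^birat)`, `Φ^rlf = rlfFunctor`, `ℝ · Φ^birat` the real span for THE
  `ℝ`-vector-space structure), with its structure functor `rlfToElem : C^rlf → F_{Φ^rlf}`;
* `untrToRlf : C^un-tr → C^rlf`, `untrPfToRlf : (C^un-tr)^pf → C^rlf` (model descriptions) and the
  1-commutativity `rlfRowTriangleIso : (C^un-tr → (C^un-tr)^pf → C^rlf) ≅ (C^un-tr → C^rlf)`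
  (`RealificationModelRow.lean`);
* on base objects all these functors are the identity; on classes `C^un-tr → C^rlf` is
  `ι^gp`, `ι = (Φ → Φ^pf → Φ^rlf)` = the natural transformation `toRlfNatTrans` (`canonical_toRlf`).

The parts of Prop. 5.3 about `C^un-tr` ITSELF being of model type (`Prop53_untr`, over the
unit-trivialization interface) are not touched here.  No statement of the paper is re-typed.
Seat abc-iut-L1-d2 (cell abc-iut), row «FrdI:Def2.4(ii)-ℝ-action + I3-MERGE RealificationData»
(L1-lead R45 (4)).
-/

noncomputable section

namespace Literature.AlgebraicGeometry.Frobenioids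

open CategoryTheory Opposite Literature.AnabelianGeometry.EtaleTheta

universe w v v' u u'

namespace PreFrobenioid

variable {D : Type u} [Category.{v} D] {Φ : Dᵒᵖ ⥤ CommMonCat.{w}}
  {C : Type u'} [Category.{v'} C] (F : C ⥤ ElemFrobenioid Φ)

/-- "`Φ` is perf-factorial" objectwise on `D` gives it on `Dᵒᵖ` (the form `RealificationData.canonical`
takes). [cite: MochizukiFrdI2008, Prop. 5.3 p.103] -/
theorem IsPerfFactorialOn.op (hΦ : IsPerfFactorialOn Φ) : ∀ X : Dᵒᵖ, IsPerfFactorial (Φ.obj X) :=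
  fun X => hΦ (unop X)

variable (hΦ : IsPerfFactorialOn Φ)

/-- **THE realification `C^rlf`** of the Frobenioid `C → F_Φ` with `Φ` perf-factorial (Prop. 5.3): "the
model Frobenioid associated to the divisor monoid `Φ^rlf` and the rational function monoid
`ℝ · Φ^birat ⊆ (Φ^rlf)^gp`" — the schema `realification F R` at THE data `R = RealificationData.canonical`.
[cite: MochizukiFrdI2008, Prop. 5.3 p.103] -/
abbrev rlf : Type (max u w) := realification F (RealificationData.canonical Φ (IsPerfFactorialOn.op hΦ))

/-- The structure functor `C^rlf → F_{Φ^rlf}` of THE realification (a model Frobenioid's `(deg_Fr, Base,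
Div)`). [cite: MochizukiFrdI2008, Prop. 5.3 p.103] -/
abbrev rlfToElem : rlf F hΦ ⥤ ElemFrobenioid (rlfFunctor Φ (IsPerfFactorialOn.op hΦ)) :=
  ModelFrobenioid.toElem _ _ _

/-- **`C^un-tr → C^rlf`** (model descriptions: model of `(Φ, Φ^birat)` → model of `(Φ^rlf, ℝ · Φ^birat)`),
the composite of the bottom row of the diagram of Prop. 5.3 at THE data.
[cite: MochizukiFrdI2008, Prop. 5.3 p.103] -/
abbrev untrToRlf : untrModel F ⥤ rlf F hΦ :=
  (RealificationData.canonical Φ (IsPerfFactorialOn.op hΦ)).toRlfModel (biratSubfunctor F)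

/-- **`(C^un-tr)^pf → C^rlf`** (model of `(Φ^pf, (Φ^birat)^pf)` → model of `(Φ^rlf, ℝ · Φ^birat)`), the last
arrow of the bottom row of the diagram of Prop. 5.3 at THE data. [cite: MochizukiFrdI2008, Prop. 5.3 p.103] -/
abbrev untrPfToRlf : untrPfModel F ⥤ rlf F hΦ :=
  (RealificationData.canonical Φ (IsPerfFactorialOn.op hΦ)).pfToRlfModel (biratSubfunctor F)

/-- **1-commutativity of the bottom row at THE data**: `(C^un-tr → (C^un-tr)^pf → C^rlf) ≅ (C^un-tr → C^rlf)`.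
[cite: MochizukiFrdI2008, Prop. 5.3 p.103] -/
def rlfRowTriangleIso : (biratSubfunctor F).toPfModel ⋙ untrPfToRlf F hΦ ≅ untrToRlf F hΦ :=
  (RealificationData.canonical Φ (IsPerfFactorialOn.op hΦ)).rowTriangleIso (biratSubfunctor F)

/-- `C^un-tr → C^rlf` is the identity on base objects. [cite: MochizukiFrdI2008, Prop. 5.3 p.103] -/
theorem untrToRlf_obj_base (X : untrModel F) : ((untrToRlf F hΦ).obj X).base = X.base := rfl

/-- On classes, `C^un-tr → C^rlf` is `ι^gp` for `ι : Φ → Φ^pf → Φ^rlf` the natural map of THE realification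
(`= toRlfNatTrans`, `RealificationData.canonical_toRlf`). [cite: MochizukiFrdI2008, Prop. 5.3 p.103] -/
theorem untrToRlf_obj_cls (X : untrModel F) :
    ((untrToRlf F hΦ).obj X).cls =
      gpApp (toRlfNatTrans Φ (IsPerfFactorialOn.op hΦ)) (op X.base) X.cls := by
  rw [← RealificationData.canonical_toRlf]
  rfl

/-- `(C^un-tr)^pf → C^rlf` is the identity on base objects. [cite: MochizukiFrdI2008, Prop. 5.3 p.103] -/
theorem untrPfToRlf_obj_base (Y : untrPfModel F) : ((untrPfToRlf F hΦ).obj Y).base = Y.base := rfl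

/-- `C^un-tr → C^rlf` preserves the Frobenius degree, the base morphism and maps `Div` by `Φ → Φ^rlf`:
its compatibility with the structure functors is t5's `functorCompToElem` at THE data.
[cite: MochizukiFrdI2008, Prop. 5.3 p.103] -/
def untrToRlfCompToElem :
    untrToRlf F hΦ ⋙ rlfToElem F hΦ ≅
      ModelFrobenioid.toElem _ _ _ ⋙
        ElemFrobenioid.mapNatTrans (RealificationData.canonical Φ (IsPerfFactorialOn.op hΦ)).toRlf :=
  ((RealificationData.canonical Φ (IsPerfFactorialOn.op hΦ)).ofBaseData (biratSubfunctor F)).functorCompToElem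

end PreFrobenioid

end Literature.AlgebraicGeometry.Frobenioids
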